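import Summits.SmoothPoincare4.SmoothPoincare4.Theorems.ConvexBisectionAcyclicBisectionExistsEOneCurveChart
import HarnessLib

/-!
# The annulus chart of the `e_1`-curve is smooth into the base and positively oriented
(wave 7, brick H5-2b of the last geometric input (R-E1CURVE) of node N3a `node_STcurve` of stub
`stub_STgeo` = NF4 N3, line `modp-braid-orbits`, crux `ConvexBisection.AcyclicBisectionExists`,
item stmt-SmoothPoincare4-10508; registered sub-goal `helper_eoChart`)

Sequel of `…EOneCurveChart.lean` (`eoChart (u, r) = pagePt g 1 (x, eoY x)`, `x = eoX g (u, r) =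
c₀ + eoRadP g r · e^{2πiu}`).  Smoothness into the base (`contMDiff_codRestrict` of the regular
domain), the core circle, and the ORIENTATION: `eoY` is holomorphic along the chart, so `∂ᵤ` and
`∂ᵣ` of the ambient chart are the complex multiples `a V`, `b V` of the single vector
`V = (λ, μ · eoY'(x))` by `a = ∂ᵤ x = 2πi (x − c₀)` and `b = ∂ᵣ x = eoRadP'(r) e^{2πiu}`, whence
`⟪∂ᵣ, i ∂ᵤ⟫ = Im (b ā) ‖V‖² = −2π eoRadP' eoRadP ‖V‖² > 0` exactly because the radius DECREASES in `r`
(`inner_mk_mul`, `im_phase` of Y4).  The six chart hypotheses of node N1a are then packaged as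
`helper_eoChart`.  Everything is proved; no `sorry`.  References: J. Milnor, *Singular points of
complex hypersurfaces* (1968), §9 [Milnor1968].
-/

noncomputable section

set_option linter.dupNamespace false

open scoped Manifold ContDiff Topology ComplexConjugate Real
open Set Function Metric Complex
open Literature.Topology.FourManifolds Literature.Topology.FourManifolds.LefschetzBase
  Literature.Topology.FourManifolds.TorusKnotMilnor

namespace Summit.SmoothPoincare4.SmoothPoincare4.Theorems.AcyclicBisectionExists.ModpBraidOrbits

variable {g : ℕ}

/-! ## §1 Smoothness into the base and the core circle -/

/-- **The chart is smooth into the base.** [cite: LeeSmoothManifolds2013, Cor. 5.30] -/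
theorem contMDiff_eoChart (hg : 2 ≤ g) : ContMDiff 𝓘(ℝ, ℝ × ℝ) (𝓡∂ 4) ∞ (eoChart hg) :=
  (RegularSublevel.halfSliceAtlas (isRegularLevel_rho g)).contMDiff_codRestrict (eoAmb_mem hg)
    (contDiff_eoAmb hg).contMDiff

/-- The chart is continuous. [folklore] -/
theorem continuous_eoChart (hg : 2 ≤ g) : Continuous (eoChart hg) :=
  Continuous.subtype_mk (contDiff_eoAmb hg).continuous _

/-- **The core circle of the chart** — the `e_1`-curve: a continuous `b : 𝕊¹ → Base g` with
`eoChart (u, 0) = b (e^{2πiu})`. [folklore] -/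
theorem exists_eoCore (hg : 2 ≤ g) :
    ∃ b : sphere (0 : EuclideanSpace ℝ (Fin 2)) 1 → Base g, Continuous b ∧
      ∀ u : ℝ, eoChart hg (u, 0) = b (circlePt u) := by
  obtain ⟨b, hb, hbu⟩ := exists_coreCircle (continuous_eoChart hg) (eoChart_periodic hg) 0 0 1 (Or.inl rfl)
  exact ⟨b, hb, fun u => by rw [hbu u]; simp⟩

/-! ## §2 The partial derivatives of the ambient chart -/

/-- **`∂ᵤ` of the ambient chart**: `(λ ∂ᵤx, μ eoY'(x) ∂ᵤx)`. [folklore] -/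
theorem hasDerivAt_eoAmb_u (hg : 2 ≤ g) (u r : ℝ) :
    HasDerivAt (fun u' => eoAmb g (u', r))
      (mk (scaleX g 1 * ((eoRadP g r : ℂ) * cexp (((2 * π * u : ℝ) : ℂ) * I) * (2 * π * I)))
          (scaleY 1 * deriv (eoY g) (eoX g (u, r)) *
            ((eoRadP g r : ℂ) * cexp (((2 * π * u : ℝ) : ℂ) * I) * (2 * π * I)))) u := by
  have hT := hasDerivAt_eoX_u g u r
  have hY := ((differentiableAt_eoY hg (eoX_mem_ann hg (u, r)).1 (eoX_mem_ann hg (u, r)).2).hasDerivAt).comp u hT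
  have h := hasDerivAt_mk_comp (hT.const_mul (scaleX g 1)) (hY.const_mul (scaleY 1))
  refine h.congr_deriv ?_
  congr 1; ring

/-- **`∂ᵣ` of the ambient chart**: `(λ ∂ᵣx, μ eoY'(x) ∂ᵣx)`. [folklore] -/
theorem hasDerivAt_eoAmb_r (hg : 2 ≤ g) (u r : ℝ) :
    HasDerivAt (fun r' => eoAmb g (u, r'))
      (mk (scaleX g 1 * (((deriv (eoRadP g) r : ℝ) : ℂ) * cexp (((2 * π * u : ℝ) : ℂ) * I)))
          (scaleY 1 * deriv (eoY g) (eoX g (u, r)) *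
            (((deriv (eoRadP g) r : ℝ) : ℂ) * cexp (((2 * π * u : ℝ) : ℂ) * I)))) r := by
  have hT := hasDerivAt_eoX_r g u r
  have hY := ((differentiableAt_eoY hg (eoX_mem_ann hg (u, r)).1 (eoX_mem_ann hg (u, r)).2).hasDerivAt).comp r hT
  have h := hasDerivAt_mk_comp (hT.const_mul (scaleX g 1)) (hY.const_mul (scaleY 1))
  refine h.congr_deriv ?_
  congr 1; ring

/-! ## §3 The chart is positively oriented -/

/-- **`0 < ⟪∂ᵣ, i ∂ᵤ⟫` on the open strip** (`eoRadP' < 0` there, `λ ≠ 0`). [folklore] -/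
theorem orient_eoChart (hg : 2 ≤ g) (u r : ℝ) (hr : r ∈ Ioo (-1 : ℝ) 1) :
    0 < inner ℝ (deriv (fun r' => (eoChart hg (u, r')).1) r)
      (cplxJ (deriv (fun u' => (eoChart hg (u', r)).1) u)) := by
  simp only [eoChart_val]
  rw [(hasDerivAt_eoAmb_r hg u r).deriv, (hasDerivAt_eoAmb_u hg u r).deriv]
  have e1 : scaleX g 1 * ((eoRadP g r : ℂ) * cexp (((2 * π * u : ℝ) : ℂ) * I) * (2 * π * I)) =
      scaleX g 1 * 1 * ((eoRadP g r : ℂ) * cexp (((2 * π * u : ℝ) : ℂ) * I) * (2 * π * I)) := by ring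
  have e2 : scaleX g 1 * (((deriv (eoRadP g) r : ℝ) : ℂ) * cexp (((2 * π * u : ℝ) : ℂ) * I)) =
      scaleX g 1 * 1 * (((deriv (eoRadP g) r : ℝ) : ℂ) * cexp (((2 * π * u : ℝ) : ℂ) * I)) := by ring
  rw [e1, e2, inner_mk_mul]
  have hP : scaleX g 1 * 1 ≠ 0 := by rw [mul_one]; exact scaleX_ne_zero (by simp)
  have hPos := Complex.normSq_pos.2 hP
  have hQ := Complex.normSq_nonneg (scaleY 1 * deriv (eoY g) (eoX g (u, r)))
  rw [im_phase]
  refine mul_pos ?_ (by linarith)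
  have h1 := deriv_eoRadP_neg (by omega : 1 ≤ g) hr
  have h2 := eoRadP_pos hg r
  nlinarith [Real.pi_pos, mul_pos Real.pi_pos (mul_pos (neg_pos.2 h1) h2)]

/-! ## §4 The registered form: the six chart hypotheses of node N1a -/

/-- **Sub-goal `helper_eoChart`** (H5-2 of the `e_1`-curve (R-E1CURVE) for node N3a of NF4): for
`g ≥ 2` the annulus chart `eoChart` of the `e_1`-curve of `page g 1` satisfies the six chart
hypotheses of node N1a — smooth into the base, `1`-periodic, cored by a continuous circle map `b`,
with values in `page g 1`, injective on `[0,1) × (−1,1)`, positively oriented — and its points are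
the scaled points `pagePt g 1 (x, eoY x)`, `x = eoX g p`. [cite: Milnor1968, §9] -/
theorem helper_eoChart : ∀ (g : ℕ) (hg : 2 ≤ g), ∃ b : Metric.sphere (0 : EuclideanSpace ℝ (Fin 2)) 1 → Literature.Topology.FourManifolds.LefschetzBase.Base g, Continuous b ∧ ContMDiff 𝓘(ℝ, ℝ × ℝ) (𝓡∂ 4) ∞ (Summit.SmoothPoincare4.SmoothPoincare4.Theorems.AcyclicBisectionExists.ModpBraidOrbits.eoChart hg) ∧ (∀ u r, Summit.SmoothPoincare4.SmoothPoincare4.Theorems.AcyclicBisectionExists.ModpBraidOrbits.eoChart hg (u + 1, r) = Summit.SmoothPoincare4.SmoothPoincare4.Theorems.AcyclicBisectionExists.ModpBraidOrbits.eoChart hg (u, r)) ∧ (∀ u, Summit.SmoothPoincare4.SmoothPoincare4.Theorems.AcyclicBisectionExists.ModpBraidOrbits.eoChart hg (u, 0) = b (Literature.Topology.FourManifolds.circlePt u)) ∧ (∀ p, Summit.SmoothPoincare4.SmoothPoincare4.Theorems.AcyclicBisectionExists.ModpBraidOrbits.eoChart hg p ∈ Literature.Topology.FourManifolds.LefschetzBase.page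 g 1) ∧ Set.InjOn (Summit.SmoothPoincare4.SmoothPoincare4.Theorems.AcyclicBisectionExists.ModpBraidOrbits.eoChart hg) (Set.Ico (0 : ℝ) 1 ×ˢ Set.Ioo (-1 : ℝ) 1) ∧ (∀ u r, r ∈ Set.Ioo (-1 : ℝ) 1 → 0 < inner ℝ (deriv (fun r' => (Summit.SmoothPoincare4.SmoothPoincare4.Theorems.AcyclicBisectionExists.ModpBraidOrbits.eoChart hg (u, r')).1) r) (Literature.Topology.FourManifolds.LefschetzBase.cplxJ (deriv (fun u' => (Summit.SmoothPoincare4.SmoothPoincare4.Theorems.AcyclicBisectionExists.ModpBraidOrbits.eoChart hg (u', r)).1) u))) ∧ (∀ p, (Summit.SmoothPoincare4.SmoothPoincare4.Theorems.AcyclicBisectionExists.ModpBraidOrbits.eoChart hg p).1 = Summit.SmoothPoincare4.SmoothPoincare4.Theorems.AcyclicBisectionExists.ModpBraidOrbits.pagePt g 1 (Summit.SmoothPoincare4.SmoothPoincare4.Theorems.AcyclicBisectionExists.ModpBraidOrbits.eoX g p) (Summit.SmoothPoincare4.SmoothPoincare4.Theorems.AcyclicBisectionExists.ModpBraidOrbits.eoY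 g (Summit.SmoothPoincare4.SmoothPoincare4.Theorems.AcyclicBisectionExists.ModpBraidOrbits.eoX g p))) := by
  intro g hg
  obtain ⟨b, hb, hbu⟩ := exists_eoCore hg
  exact ⟨b, hb, contMDiff_eoChart hg, eoChart_periodic hg, hbu, helper_eoChart_mem_page g hg,
    eoChart_injOn hg, orient_eoChart hg, fun p => rfl⟩

end Summit.SmoothPoincare4.SmoothPoincare4.Theorems.AcyclicBisectionExists.ModpBraidOrbits

end
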